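import Summits.Ventures.CertifiedManyBodySolver.Observables.SourcedGibbsTrialCapKSpaceSymbol
import HarnessLib

/-!
# The HF–BCS sourced cap in momentum space (II): the Fermi matrix of the free `d`-wave pinned torus
# in momentum space (Bloch–Fourier / BdG block diagonalisation)

HONEST FRAMING: zero compute in this file; every statement is a PROVED finite-volume identity / inequality about
the free (`U = 0`) `d`-wave pinned torus and the Hartree–Fock–BCS trial-state cap; no number is claimed here (the
certified interval evaluation of the resulting finite sum is a separate kit job of the `hubbard-obs` cell); a sourced
variational CAP bounds nothing about order by itself — it feeds the FLOOR edge of the finite-`h` Hellmann–Feynman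
bracket only together with a certified source-free lower row; not a statement about order of the source-free model;
not a superconductivity verdict.

With `ξ_k = ε_L(k) − μ'`, `g_k = 2√2 h ĝ_d(k)`, `E_k = √(ξ_k² + g_k²)` (`L ≥ 3`):

* `tanh_half_eq_sinh_div`, `bdg_block_inverse_00/01/11`, `bdg_block_data` — the `2 × 2` block algebra
  `N̂(k) Ŝ(k) = 1` for `N̂(k) = (1 + cosh βE_k)·1 + (sinh(βE_k)/E_k)·𝓗_k` (symbol of `1 + e^{β𝓗}`) and
  `Ŝ(k) = ½·1 − (tanh(βE_k/2)/(2E_k))·𝓗_k`, `𝓗_k = [[ξ_k, g_k],[g_k, −ξ_k]]`, as polynomial identities (valid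
  also at `E_k = 0` with Lean's `x/0 = 0`);
* `sum_one_add_exp_dWaveNambu_mul_torusChar` — the plane-wave symbol of `1 + e^{β𝓗}`;
* `fermiMatrix_dWaveNambu_apply` — **`[(1 + e^{β𝓗})⁻¹]_{(x,σ),(y,σ')} = L⁻² Σ_k χ_k(x − y) Ŝ(k)_{σσ'}`**, by the
  plane-wave inversion `FermionTorusPlaneWaveInversion.inv_apply_eq_sum_torusChar`.

References: von Delft–Ralph, Phys. Rep. 345 (2001) 61, §4.2 [VondelftRalph2001]; Bach–Lieb–Solovej, J. Stat.
Phys. 76 (1994) 3, §2 [BachLiebSolovej1994].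
-/

noncomputable section

open Matrix Finset Literature.MathematicalPhysics.QuantumLattice Literature.Probability.LatticeModels
open scoped ComplexConjugate

namespace Summit.Ventures.CertifiedManyBodySolver.Observables

/-! ### §3 The Fermi matrix of the free `d`-wave pinned torus in momentum space -/

section FermiMatrix

variable {L : ℕ} [NeZero L]

/-- Half-angle formula `tanh(x/2) = sinh x / (1 + cosh x)`. [folklore] -/
theorem tanh_half_eq_sinh_div (x : ℝ) : Real.tanh (x / 2) = Real.sinh x / (1 + Real.cosh x) := by
  have hc : Real.cosh (x / 2) ≠ 0 := (Real.cosh_pos _).ne'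
  have hden : 1 + Real.cosh x ≠ 0 := by have := Real.one_le_cosh x; positivity
  have hs : Real.sinh x = 2 * Real.sinh (x / 2) * Real.cosh (x / 2) := by
    conv_lhs => rw [show x = 2 * (x / 2) by ring]
    exact Real.sinh_two_mul (x / 2)
  have hc2 : Real.cosh x = Real.cosh (x / 2) ^ 2 + Real.sinh (x / 2) ^ 2 := by
    conv_lhs => rw [show x = 2 * (x / 2) by ring]
    exact Real.cosh_two_mul (x / 2)
  rw [Real.tanh_eq_sinh_div_cosh, div_eq_div_iff hc hden, hs, hc2]
  have hsq := Real.cosh_sq (x / 2)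
  linear_combination (-Real.sinh (x / 2)) * hsq

/-- The `2 × 2` block algebra `N̂(k) Ŝ(k) = 1`, entry `(↑,↑)`: polynomial identity in
`c = cosh βE, s = sinh βE, r = s/E, d = 1/(2(1+c)), q = tanh(βE/2)/(2E) = r d`. [cite: VondelftRalph2001, §4.2] -/
theorem bdg_block_inverse_00 {c s r q d ξ g E : ℝ} (hcs : c ^ 2 - s ^ 2 = 1) (hd : d * (2 * (1 + c)) = 1)
    (hr : r * E = s) (hE : ξ ^ 2 + g ^ 2 = E ^ 2) (hq : q = r * d) :
    (1 + c + ξ * r) * (1 / 2 - q * ξ) + (g * r) * (-(q * g)) = 1 := by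
  linear_combination d * hcs - ((c - 1 + ξ * r) / 2) * hd - d * (r * E + s) * hr - r ^ 2 * d * hE +
    (-ξ * (1 + c) - (ξ ^ 2 + g ^ 2) * r) * hq

/-- The `2 × 2` block algebra `N̂(k) Ŝ(k) = 1`, entry `(↓,↓)`. [cite: VondelftRalph2001, §4.2] -/
theorem bdg_block_inverse_11 {c s r q d ξ g E : ℝ} (hcs : c ^ 2 - s ^ 2 = 1) (hd : d * (2 * (1 + c)) = 1)
    (hr : r * E = s) (hE : ξ ^ 2 + g ^ 2 = E ^ 2) (hq : q = r * d) :
    (g * r) * (-(q * g)) + (1 + c - ξ * r) * (1 / 2 + q * ξ) = 1 := by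
  linear_combination d * hcs - ((c - 1 - ξ * r) / 2) * hd - d * (r * E + s) * hr - r ^ 2 * d * hE +
    (ξ * (1 + c) - (ξ ^ 2 + g ^ 2) * r) * hq

/-- The `2 × 2` block algebra `N̂(k) Ŝ(k) = 1`, off-diagonal entries. [cite: VondelftRalph2001, §4.2] -/
theorem bdg_block_inverse_01 {c r q d ξ g : ℝ} (hd : d * (2 * (1 + c)) = 1) (hq : q = r * d) :
    (1 + c + ξ * r) * (-(q * g)) + (g * r) * (1 / 2 + q * ξ) = 0 := by
  linear_combination (-(g * r / 2)) * hd + (-(1 + c) * g) * hq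

/-- The block data of the quasi-particle energy `E = √(ξ² + g²)`: `r = sinh(βE)/E`, `d = 1/(2(1 + cosh βE))`,
`q = tanh(βE/2)/(2E)` satisfy `rE = sinh βE`, `d·2(1 + cosh βE) = 1`, `q = r d` (also when `E = 0`).
[cite: VondelftRalph2001, §4.2] -/
theorem bdg_block_data (β ξ g : ℝ) :
    Real.cosh (β * Real.sqrt (ξ ^ 2 + g ^ 2)) ^ 2 - Real.sinh (β * Real.sqrt (ξ ^ 2 + g ^ 2)) ^ 2 = 1 ∧
    (2 * (1 + Real.cosh (β * Real.sqrt (ξ ^ 2 + g ^ 2))))⁻¹ * (2 * (1 + Real.cosh (β * Real.sqrt (ξ ^ 2 + g ^ 2)))) = 1 ∧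
    Real.sinh (β * Real.sqrt (ξ ^ 2 + g ^ 2)) / Real.sqrt (ξ ^ 2 + g ^ 2) * Real.sqrt (ξ ^ 2 + g ^ 2) =
      Real.sinh (β * Real.sqrt (ξ ^ 2 + g ^ 2)) ∧
    ξ ^ 2 + g ^ 2 = Real.sqrt (ξ ^ 2 + g ^ 2) ^ 2 ∧
    Real.tanh (β * Real.sqrt (ξ ^ 2 + g ^ 2) / 2) / (2 * Real.sqrt (ξ ^ 2 + g ^ 2)) =
      Real.sinh (β * Real.sqrt (ξ ^ 2 + g ^ 2)) / Real.sqrt (ξ ^ 2 + g ^ 2) *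
        (2 * (1 + Real.cosh (β * Real.sqrt (ξ ^ 2 + g ^ 2))))⁻¹ := by
  set E := Real.sqrt (ξ ^ 2 + g ^ 2) with hE
  have hden : (2 * (1 + Real.cosh (β * E))) ≠ 0 := by have := Real.one_le_cosh (β * E); positivity
  refine ⟨Real.cosh_sq_sub_sinh_sq _, inv_mul_cancel₀ hden, ?_, (Real.sq_sqrt (by positivity)).symm, ?_⟩
  · rcases eq_or_ne E 0 with hE0 | hE0
    · rw [hE0]; simp
    · exact div_mul_cancel₀ _ hE0
  · rcases eq_or_ne E 0 with hE0 | hE0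
    · rw [hE0]; simp
    · rw [tanh_half_eq_sinh_div]
      field_simp

/-- **Plane-wave symbol of `1 + e^{β𝓗}` for the free `d`-wave pinned torus**: with `ξ_k = ε_L(k) - μ'`,
`g_k = 2√2 h ĝ_d(k)`, `E_k = √(ξ_k² + g_k²)`, `c_k = cosh βE_k`, `r_k = sinh(βE_k)/E_k`,
`Σ_y (1 + e^{β𝓗})((x,σ),(y,σ')) χ_k(y − w) = χ_k(x − w) N̂(k)_{σσ'}`,
`N̂(k) = (1 + c_k)·1 + r_k·[[ξ_k, g_k],[g_k, −ξ_k]]` (`L ≥ 3`). [cite: VondelftRalph2001, §4.2] -/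
theorem sum_one_add_exp_dWaveNambu_mul_torusChar (hL : 3 ≤ L) (μ' h β : ℝ) (k w : TorusSite 2 L)
    (x : FermionTorus 2 L) (σ σ' : Fin 2) :
    ∑ y : FermionTorus 2 L,
        (1 + NormedSpace.exp ((β : ℂ) • bdgNambuMatrix
          (fun x y => if (fermionTorusGraph 2 L).Adj x y then -(1 : ℂ) else 0)
          (fun u v : FermionTorus 2 L => -(h : ℂ) * ∑ i : Fin 2,
            if v = FermionTorus.ofTorusSite (u.toTorusSite + Pi.single i 1) then
              ((Real.sqrt 2 * (if i = 0 then 1 else -1) : ℝ) : ℂ) else 0) μ')) (orb x σ) (orb y σ') *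
          torusChar k (y.toTorusSite - w) =
      torusChar k (x.toTorusSite - w) *
        (if σ = 0 then
          (if σ' = 0 then
            ((1 + Real.cosh (β * Real.sqrt ((torusBand L k - μ') ^ 2 + (2 * Real.sqrt 2 * h * dWaveGap k) ^ 2)) +
              (torusBand L k - μ') *
                (Real.sinh (β * Real.sqrt ((torusBand L k - μ') ^ 2 + (2 * Real.sqrt 2 * h * dWaveGap k) ^ 2)) /
                  Real.sqrt ((torusBand L k - μ') ^ 2 + (2 * Real.sqrt 2 * h * dWaveGap k) ^ 2)) : ℝ) : ℂ)
          else
            (((2 * Real.sqrt 2 * h * dWaveGap k) *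
                (Real.sinh (β * Real.sqrt ((torusBand L k - μ') ^ 2 + (2 * Real.sqrt 2 * h * dWaveGap k) ^ 2)) /
                  Real.sqrt ((torusBand L k - μ') ^ 2 + (2 * Real.sqrt 2 * h * dWaveGap k) ^ 2)) : ℝ) : ℂ))
        else
          (if σ' = 0 then
            (((2 * Real.sqrt 2 * h * dWaveGap k) *
                (Real.sinh (β * Real.sqrt ((torusBand L k - μ') ^ 2 + (2 * Real.sqrt 2 * h * dWaveGap k) ^ 2)) /
                  Real.sqrt ((torusBand L k - μ') ^ 2 + (2 * Real.sqrt 2 * h * dWaveGap k) ^ 2)) : ℝ) : ℂ)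
          else
            ((1 + Real.cosh (β * Real.sqrt ((torusBand L k - μ') ^ 2 + (2 * Real.sqrt 2 * h * dWaveGap k) ^ 2)) -
              (torusBand L k - μ') *
                (Real.sinh (β * Real.sqrt ((torusBand L k - μ') ^ 2 + (2 * Real.sqrt 2 * h * dWaveGap k) ^ 2)) /
                  Real.sqrt ((torusBand L k - μ') ^ 2 + (2 * Real.sqrt 2 * h * dWaveGap k) ^ 2)) : ℝ) : ℂ))) := by
  set H := bdgNambuMatrix
          (fun x y => if (fermionTorusGraph 2 L).Adj x y then -(1 : ℂ) else 0)
          (fun u v : FermionTorus 2 L => -(h : ℂ) * ∑ i : Fin 2,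
            if v = FermionTorus.ofTorusSite (u.toTorusSite + Pi.single i 1) then
              ((Real.sqrt 2 * (if i = 0 then 1 else -1) : ℝ) : ℂ) else 0) μ' with hH
  set M := 1 + NormedSpace.exp ((β : ℂ) • H) with hM
  -- a column of `M` against a plane wave is `M` applied to the plane wave
  have hcol : ∀ τ : Fin 2, ∑ y : FermionTorus 2 L, M (orb x σ) (orb y τ) * torusChar k y.toTorusSite =
      (M *ᵥ planeWave k τ) (orb x σ) := by
    intro τ
    simp only [Matrix.mulVec, dotProduct]
    rw [sum_orb_eq_sum_sum]
    simp only [planeWave_orb, mul_ite, mul_zero, Finset.sum_ite_eq', Finset.mem_univ, if_true]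
  have hshift : ∑ y : FermionTorus 2 L, M (orb x σ) (orb y σ') * torusChar k (y.toTorusSite - w) =
      (∑ y : FermionTorus 2 L, M (orb x σ) (orb y σ') * torusChar k y.toTorusSite) * conj (torusChar k w) := by
    rw [Finset.sum_mul]
    exact Finset.sum_congr rfl fun y _ => by rw [torusChar_sub_right]; ring
  have h0 := dWaveNambu_mulVec_planeWave_zero hL μ' h k
  have h1 := dWaveNambu_mulVec_planeWave_one hL μ' h k
  rw [← hH] at h0 h1
  have hexp0 := exp_smul_mulVec_of_two_block H β (torusBand L k - μ') (2 * Real.sqrt 2 * h * dWaveGap k) h0 h1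
  have hexp1 := exp_smul_mulVec_of_two_block' H β (torusBand L k - μ') (2 * Real.sqrt 2 * h * dWaveGap k) h0 h1
  rw [hshift, hcol σ', hM, Matrix.add_mulVec, Matrix.one_mulVec, Pi.add_apply, torusChar_sub_right]
  by_cases hσ' : σ' = 0
  · subst hσ'
    rw [hexp0]
    simp only [Pi.add_apply, Pi.smul_apply, smul_eq_mul, planeWave_orb, if_true]
    by_cases hσ : σ = 0
    · subst hσ; simp only [if_true]; push_cast; ring
    · obtain rfl : σ = 1 := Fin.eq_one_of_ne_zero σ hσ
      simp only [one_ne_zero, if_false, if_true]; push_cast; ring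
  · obtain rfl : σ' = 1 := Fin.eq_one_of_ne_zero σ' hσ'
    rw [hexp1]
    simp only [Pi.add_apply, Pi.smul_apply, smul_eq_mul, planeWave_orb, one_ne_zero, if_false]
    by_cases hσ : σ = 0
    · subst hσ; simp only [if_true, zero_ne_one, if_false]; push_cast; ring
    · obtain rfl : σ = 1 := Fin.eq_one_of_ne_zero σ hσ
      simp only [one_ne_zero, if_false, if_true]; push_cast; ring

/-- **The Fermi matrix of the free `d`-wave pinned torus in momentum space** (Bloch–Fourier / BdG):
with `ξ_k = ε_L(k) - μ'`, `g_k = 2√2 h ĝ_d(k)`, `E_k = √(ξ_k² + g_k²)`, `q_k = tanh(βE_k/2)/(2E_k)`,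
`[(1 + e^{β𝓗_{L,μ',h}})⁻¹]_{(x,σ),(y,σ')} = L⁻² Σ_k χ_k(x − y) Ŝ(k)_{σσ'}`,
`Ŝ(k) = ½·1 − q_k·[[ξ_k, g_k],[g_k, −ξ_k]]` (`L ≥ 3`; `(1 + e^{β𝓗_k})⁻¹ = ½ − (tanh(βE_k/2)/2E_k)𝓗_k`
since `𝓗_k² = E_k²`). [cite: VondelftRalph2001, §4.2] [cite: BachLiebSolovej1994, §2] -/
theorem fermiMatrix_dWaveNambu_apply (hL : 3 ≤ L) (μ' h β : ℝ) (x y : FermionTorus 2 L) (σ σ' : Fin 2) :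
    (1 + NormedSpace.exp ((β : ℂ) • bdgNambuMatrix
          (fun x y => if (fermionTorusGraph 2 L).Adj x y then -(1 : ℂ) else 0)
          (fun u v : FermionTorus 2 L => -(h : ℂ) * ∑ i : Fin 2,
            if v = FermionTorus.ofTorusSite (u.toTorusSite + Pi.single i 1) then
              ((Real.sqrt 2 * (if i = 0 then 1 else -1) : ℝ) : ℂ) else 0) μ'))⁻¹ (orb x σ) (orb y σ') =
      ((L : ℂ) ^ 2)⁻¹ * ∑ k : TorusSite 2 L, torusChar k (x.toTorusSite - y.toTorusSite) *
        (if σ = 0 then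
          (if σ' = 0 then
            ((1 / 2 - Real.tanh (β * Real.sqrt ((torusBand L k - μ') ^ 2 + (2 * Real.sqrt 2 * h * dWaveGap k) ^ 2) / 2) /
                (2 * Real.sqrt ((torusBand L k - μ') ^ 2 + (2 * Real.sqrt 2 * h * dWaveGap k) ^ 2)) *
                  (torusBand L k - μ') : ℝ) : ℂ)
          else
            ((-(Real.tanh (β * Real.sqrt ((torusBand L k - μ') ^ 2 + (2 * Real.sqrt 2 * h * dWaveGap k) ^ 2) / 2) /
                (2 * Real.sqrt ((torusBand L k - μ') ^ 2 + (2 * Real.sqrt 2 * h * dWaveGap k) ^ 2)) *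
                  (2 * Real.sqrt 2 * h * dWaveGap k)) : ℝ) : ℂ))
        else
          (if σ' = 0 then
            ((-(Real.tanh (β * Real.sqrt ((torusBand L k - μ') ^ 2 + (2 * Real.sqrt 2 * h * dWaveGap k) ^ 2) / 2) /
                (2 * Real.sqrt ((torusBand L k - μ') ^ 2 + (2 * Real.sqrt 2 * h * dWaveGap k) ^ 2)) *
                  (2 * Real.sqrt 2 * h * dWaveGap k)) : ℝ) : ℂ)
          else
            ((1 / 2 + Real.tanh (β * Real.sqrt ((torusBand L k - μ') ^ 2 + (2 * Real.sqrt 2 * h * dWaveGap k) ^ 2) / 2) /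
                (2 * Real.sqrt ((torusBand L k - μ') ^ 2 + (2 * Real.sqrt 2 * h * dWaveGap k) ^ 2)) *
                  (torusBand L k - μ') : ℝ) : ℂ))) := by
  have key := inv_apply_eq_sum_torusChar (d := 2)
    (1 + NormedSpace.exp ((β : ℂ) • bdgNambuMatrix
          (fun x y => if (fermionTorusGraph 2 L).Adj x y then -(1 : ℂ) else 0)
          (fun u v : FermionTorus 2 L => -(h : ℂ) * ∑ i : Fin 2,
            if v = FermionTorus.ofTorusSite (u.toTorusSite + Pi.single i 1) then
              ((Real.sqrt 2 * (if i = 0 then 1 else -1) : ℝ) : ℂ) else 0) μ'))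
    (fun k σ σ' =>
        if σ = 0 then
          (if σ' = 0 then
            ((1 + Real.cosh (β * Real.sqrt ((torusBand L k - μ') ^ 2 + (2 * Real.sqrt 2 * h * dWaveGap k) ^ 2)) +
              (torusBand L k - μ') *
                (Real.sinh (β * Real.sqrt ((torusBand L k - μ') ^ 2 + (2 * Real.sqrt 2 * h * dWaveGap k) ^ 2)) /
                  Real.sqrt ((torusBand L k - μ') ^ 2 + (2 * Real.sqrt 2 * h * dWaveGap k) ^ 2)) : ℝ) : ℂ)
          else
            (((2 * Real.sqrt 2 * h * dWaveGap k) *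
                (Real.sinh (β * Real.sqrt ((torusBand L k - μ') ^ 2 + (2 * Real.sqrt 2 * h * dWaveGap k) ^ 2)) /
                  Real.sqrt ((torusBand L k - μ') ^ 2 + (2 * Real.sqrt 2 * h * dWaveGap k) ^ 2)) : ℝ) : ℂ))
        else
          (if σ' = 0 then
            (((2 * Real.sqrt 2 * h * dWaveGap k) *
                (Real.sinh (β * Real.sqrt ((torusBand L k - μ') ^ 2 + (2 * Real.sqrt 2 * h * dWaveGap k) ^ 2)) /
                  Real.sqrt ((torusBand L k - μ') ^ 2 + (2 * Real.sqrt 2 * h * dWaveGap k) ^ 2)) : ℝ) : ℂ)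
          else
            ((1 + Real.cosh (β * Real.sqrt ((torusBand L k - μ') ^ 2 + (2 * Real.sqrt 2 * h * dWaveGap k) ^ 2)) -
              (torusBand L k - μ') *
                (Real.sinh (β * Real.sqrt ((torusBand L k - μ') ^ 2 + (2 * Real.sqrt 2 * h * dWaveGap k) ^ 2)) /
                  Real.sqrt ((torusBand L k - μ') ^ 2 + (2 * Real.sqrt 2 * h * dWaveGap k) ^ 2)) : ℝ) : ℂ)))
    (fun k σ σ' =>
        if σ = 0 then
          (if σ' = 0 then
            ((1 / 2 - Real.tanh (β * Real.sqrt ((torusBand L k - μ') ^ 2 + (2 * Real.sqrt 2 * h * dWaveGap k) ^ 2) / 2) /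
                (2 * Real.sqrt ((torusBand L k - μ') ^ 2 + (2 * Real.sqrt 2 * h * dWaveGap k) ^ 2)) *
                  (torusBand L k - μ') : ℝ) : ℂ)
          else
            ((-(Real.tanh (β * Real.sqrt ((torusBand L k - μ') ^ 2 + (2 * Real.sqrt 2 * h * dWaveGap k) ^ 2) / 2) /
                (2 * Real.sqrt ((torusBand L k - μ') ^ 2 + (2 * Real.sqrt 2 * h * dWaveGap k) ^ 2)) *
                  (2 * Real.sqrt 2 * h * dWaveGap k)) : ℝ) : ℂ))
        else
          (if σ' = 0 then
            ((-(Real.tanh (β * Real.sqrt ((torusBand L k - μ') ^ 2 + (2 * Real.sqrt 2 * h * dWaveGap k) ^ 2) / 2) /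
                (2 * Real.sqrt ((torusBand L k - μ') ^ 2 + (2 * Real.sqrt 2 * h * dWaveGap k) ^ 2)) *
                  (2 * Real.sqrt 2 * h * dWaveGap k)) : ℝ) : ℂ)
          else
            ((1 / 2 + Real.tanh (β * Real.sqrt ((torusBand L k - μ') ^ 2 + (2 * Real.sqrt 2 * h * dWaveGap k) ^ 2) / 2) /
                (2 * Real.sqrt ((torusBand L k - μ') ^ 2 + (2 * Real.sqrt 2 * h * dWaveGap k) ^ 2)) *
                  (torusBand L k - μ') : ℝ) : ℂ)))
    (fun k w x σ σ' => sum_one_add_exp_dWaveNambu_mul_torusChar hL μ' h β k w x σ σ')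
    (by
      intro k σ σ''
      obtain ⟨hcs, hd, hr, hE, hq⟩ := bdg_block_data β (torusBand L k - μ') (2 * Real.sqrt 2 * h * dWaveGap k)
      rw [Fin.sum_univ_two]
      by_cases hσ : σ = 0
      · subst hσ
        by_cases hσ'' : σ'' = 0
        · subst hσ''
          simp only [if_true, one_ne_zero, if_false]
          exact_mod_cast bdg_block_inverse_00 hcs hd hr hE hq
        · obtain rfl : σ'' = 1 := Fin.eq_one_of_ne_zero σ'' hσ''
          simp only [if_true, one_ne_zero, zero_ne_one, if_false]
          exact_mod_cast bdg_block_inverse_01 (ξ := torusBand L k - μ') (g := 2 * Real.sqrt 2 * h * dWaveGap k) hd hq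
      · obtain rfl : σ = 1 := Fin.eq_one_of_ne_zero σ hσ
        by_cases hσ'' : σ'' = 0
        · subst hσ''
          simp only [if_true, one_ne_zero, if_false]
          have h01 := bdg_block_inverse_01 (ξ := torusBand L k - μ') (g := 2 * Real.sqrt 2 * h * dWaveGap k) hd hq
          have h10 : (2 * Real.sqrt 2 * h * dWaveGap k) *
                (Real.sinh (β * Real.sqrt ((torusBand L k - μ') ^ 2 + (2 * Real.sqrt 2 * h * dWaveGap k) ^ 2)) /
                  Real.sqrt ((torusBand L k - μ') ^ 2 + (2 * Real.sqrt 2 * h * dWaveGap k) ^ 2)) *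
              (1 / 2 - Real.tanh (β * Real.sqrt ((torusBand L k - μ') ^ 2 + (2 * Real.sqrt 2 * h * dWaveGap k) ^ 2) / 2) /
                (2 * Real.sqrt ((torusBand L k - μ') ^ 2 + (2 * Real.sqrt 2 * h * dWaveGap k) ^ 2)) *
                  (torusBand L k - μ')) +
            (1 + Real.cosh (β * Real.sqrt ((torusBand L k - μ') ^ 2 + (2 * Real.sqrt 2 * h * dWaveGap k) ^ 2)) -
              (torusBand L k - μ') *
                (Real.sinh (β * Real.sqrt ((torusBand L k - μ') ^ 2 + (2 * Real.sqrt 2 * h * dWaveGap k) ^ 2)) /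
                  Real.sqrt ((torusBand L k - μ') ^ 2 + (2 * Real.sqrt 2 * h * dWaveGap k) ^ 2))) *
              (-(Real.tanh (β * Real.sqrt ((torusBand L k - μ') ^ 2 + (2 * Real.sqrt 2 * h * dWaveGap k) ^ 2) / 2) /
                (2 * Real.sqrt ((torusBand L k - μ') ^ 2 + (2 * Real.sqrt 2 * h * dWaveGap k) ^ 2)) *
                  (2 * Real.sqrt 2 * h * dWaveGap k))) = 0 := by
            linear_combination h01
          exact_mod_cast h10
        · obtain rfl : σ'' = 1 := Fin.eq_one_of_ne_zero σ'' hσ''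
          simp only [one_ne_zero, if_false, if_true]
          exact_mod_cast bdg_block_inverse_11 hcs hd hr hE hq)
    (orb x σ) (orb y σ')
  simp only [ofLex_toLex] at key
  exact key

end FermiMatrix

end Summit.Ventures.CertifiedManyBodySolver.Observables

end
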